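import Literature.IUT.HodgeArakelov.MonoThetaCor110FamilyOfBase
import Literature.IUT.HodgeArakelov.ModelCyclotomesAutTransport
import Literature.AnabelianGeometry.EtaleTheta.Discharge.Sec2Cor219iCoefficientAction

/-!
# [IUTchII] Cor. 1.10 at the [EtTh] model, mod `N`: the base datum with its `Aut(Π^tp_X)`-action, hence the
# functorial family and the multiradiality statement, from [EtTh] Cor. 2.18 (i) (+ Cor. 2.19 (i) for the lifts)

S. Mochizuki, *Inter-universal Teichmüller theory II*, §1, Cor. 1.10, kurims p. 47 [claim: Mochizuki2012, status:
disputed] (IUTchII §1 Cor 1.10, kurims p.47); [EtTh] Cor. 2.18 (i) p.60, Cor. 2.19 (i) p.64 (`MochizukiEtTh2009`).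
abc-iut cell, abc-iut-w5-d145: sub-DAG `plan/L6/SUBDAG-IUTchII-Cor-110.md` rows C110-S10a/S10b/S10c assembled
AT THE [EtTh] MODEL of L2's `R : RigidData S.N l` framed in the [IUTchII] §1 setting `S` by an identification
`eX : Π^tp_X ⥲ Π^tp_{X̲̲_k}`, at LEVEL `N` (the mod-`N` truncation of Cor. 1.10's cyclotomes: `(l·Δ_Θ)(M) ⊗ ℤ/Nℤ`
and `Π_μ(M_N) = μ_N`, related by the Def. 1.1 (ii) isomorphism; Cor. 1.10's `Π_μ(M^Θ_*)` / `(l·Δ_Θ)` are the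
limits over `N`, not formed here).

GIVEN the named fact [EtTh] Cor. 2.18 (i) (`R.Cor218_i`: every automorphism of the topological group `Π^tp_X`
preserves `Π^tp_Y`, `Π^tp_Ÿ`, `Δ`, `thetaKer`, the inverse image of `l·Δ_Θ`, and the cusps), this file CONSTRUCTS
`ModelCyclotomes.baseDatumModN : MonoThetaBaseDatum S Π₀` (`Π₀ := Π^tp_X` as an isomorph of `Π^tp_{X̲̲_k}`):
* `A := (l·Δ_Θ)(M) ⊗ ℤ/N` (B8 part 5a's interior cyclotome mod `N`, with the conjugation action descended,
  `actModN`; commutative because `intModEquiv` identifies it with `μ_N`), `B := μ_N` with `χ ∘ aug`,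
  `iso := intModEquiv R` (induced by `thetaMod` = the difference of the two splittings), equivariant
  (`intModEquiv_conj`);
* `ρ_A(γ) :=` the automorphism induced by `γ ∈ Aut(Π^tp_X)` on the interior cyclotome (`intCycAutOfCor218i`,
  row S10b) descended mod `N`; `ρ_B(γ) := γ̄_μ`, the COEFFICIENT AUTOMORPHISM of `γ` on `μ_N` — DEFINED as the
  transport of `ρ_A(γ)` through `intModEquiv` (`coeffAut`), and PROVED to satisfy `thetaMod (γ g) = γ̄_μ (thetaMod g)`
  (`thetaMod_coeffAut`: it IS L2's coefficient automorphism of `RigidData.exists_mulEquiv_thetaMod_comp`) and to be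
  the action on `μ_N ⊆ Π^tp_Y[μ_N]` of EVERY automorphism of the model mono-theta environment lying over `γ`
  (`iso_inMu_eq_coeffAut'`, from row S10c = [EtTh] Cor. 2.19 (i)) — so `ρ_B` is the [EtTh] Cor. 2.18 (iv) action of
  lifts, not an arbitrary choice;
* all laws of `MonoThetaBaseDatum` PROVED; hence (`MonoThetaBaseDatum.family`, p415127) the FUNCTORIAL FAMILY
  `familyModN : MonoThetaRigidityData S` of [IUTchII] Cor. 1.10 at the model mod `N` and its printed conclusion
  `cor110_multiradiallyDefined_modelModN` ("`Ψ_ℛ : ℛ → ℛ†` is multiradially defined") — modulo `Cor218_i` only.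

HONEST FRAMING: a construction over a refereed source's typed interface plus one of its named statements as
hypothesis; the [IUTchII] side is the claim key `Mochizuki2012` (DISPUTED) and nothing disputed is asserted; no side
is taken on [IUTchIII] Cor. 3.12; typed ≠ discharged. This is the mod-`N` MODEL instance; the genuine Cor. 1.10
base datum (limit cyclotomes over `EtaleLevels.modelFamily`) remains row r6/S8 of the sub-DAG.
-/

noncomputable section

namespace Literature.IUT.HodgeArakelov

open CategoryTheory Literature.AnabelianGeometry.EtaleTheta

universe u

namespace ModelCyclotomes

variable {S : ThetaSetting.{u}} {l : ℕ} (R : RigidData.{u} S.N l)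

/-! ## `(l·Δ_Θ)(M) ⊗ ℤ/N` is commutative; the descended conjugation action -/

/-- `(l·Δ_Θ)(M) ⊗ ℤ/Nℤ` is commutative (it is identified with `μ_N` by `intModEquiv`). An explicit structure
term (no instance is declared). [claim: Mochizuki2012, status: disputed] (IUTchII §1 Def 1.1 (ii), kurims p.21) -/
@[reducible] def commGroupModN : CommGroup (ModPow (intCyc R).carrier (S.N : ℕ)) :=
  { (inferInstance : Group (ModPow (intCyc R).carrier (S.N : ℕ))) with
    mul_comm := fun a b => (intModEquiv R).injective (by rw [map_mul, map_mul, mul_comm]) }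

/-- `(l·Δ_Θ)(M) ⊗ ℤ/Nℤ` as a bundled commutative group. [claim: Mochizuki2012, status: disputed] (IUTchII §1 Def 1.1 (ii), kurims p.21) -/
def intModN : CommGrpCat.{u} := @CommGrpCat.mk (ModPow (intCyc R).carrier (S.N : ℕ)) (commGroupModN R)

/-- `modPowCongr` is functorial: identity. [claim: Mochizuki2012, status: disputed] (IUTchII §1 Def 1.1 (ii), kurims p.21) -/
theorem modPowCongr_refl {A : Type u} [Group A] (n : ℕ) : modPowCongr (MulEquiv.refl A) n = MulEquiv.refl _ := by
  refine MulEquiv.ext fun c => ?_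
  induction c using QuotientGroup.induction_on with
  | H a => rw [modPowCongr_mk]; rfl

/-- `modPowCongr` is functorial: composition. [claim: Mochizuki2012, status: disputed] (IUTchII §1 Def 1.1 (ii), kurims p.21) -/
theorem modPowCongr_trans {A B C : Type u} [Group A] [Group B] [Group C] (e : A ≃* B) (f : B ≃* C) (n : ℕ) :
    modPowCongr (e.trans f) n = (modPowCongr e n).trans (modPowCongr f n) := by
  refine MulEquiv.ext fun c => ?_
  induction c using QuotientGroup.induction_on with
  | H a => rw [MulEquiv.trans_apply, modPowCongr_mk, modPowCongr_mk, modPowCongr_mk]; rfl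

/-- **The `Π^tp_X`-action on `(l·Δ_Θ)(M) ⊗ ℤ/N`**: the conjugation action `intAct` descended mod `N`.
[claim: Mochizuki2012, status: disputed] (IUTchII §1 Def 1.1 (i), kurims p.21) -/
def actModN : R.PiX →* MulAut (ModPow (intCyc R).carrier (S.N : ℕ)) where
  toFun x := modPowCongr (intAct R x) (S.N : ℕ)
  map_one' := by rw [map_one]; exact modPowCongr_refl _
  map_mul' x y := by
    rw [map_mul]
    change modPowCongr ((intAct R y).trans (intAct R x)) _ = _
    rw [modPowCongr_trans]
    rfl

/-- `actModN` on classes. [claim: Mochizuki2012, status: disputed] (IUTchII §1 Def 1.1 (i), kurims p.21) -/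
@[simp] theorem actModN_mk (x : R.PiX) (c : (intCyc R).carrier) :
    actModN R x (c : ModPow (intCyc R).carrier (S.N : ℕ)) = ((intAct R x c : (intCyc R).carrier) : ModPow (intCyc R).carrier (S.N : ℕ)) :=
  modPowCongr_mk _ _ c

/-! ## `ρ_A` mod `N` and the coefficient automorphism `ρ_B = γ̄_μ` -/

/-- **`ρ_A(γ)` mod `N`**: the automorphism of `(l·Δ_Θ)(M) ⊗ ℤ/N` induced by `γ ∈ Aut(Π^tp_X)` (row S10b's
`intCycAutOfCor218i`, descended). [cite: MochizukiEtTh2009, Cor 2.18(i) p.60] -/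
def rhoModN (h218i : R.Cor218_i) (γ : R.PiX ≃ₜ* R.PiX) : ModPow (intCyc R).carrier (S.N : ℕ) ≃* ModPow (intCyc R).carrier (S.N : ℕ) :=
  modPowCongr (intCycAutOfCor218i R h218i γ) (S.N : ℕ)

/-- `rhoModN` on classes. [cite: MochizukiEtTh2009, Cor 2.18(i) p.60] -/
@[simp] theorem rhoModN_mk (h218i : R.Cor218_i) (γ : R.PiX ≃ₜ* R.PiX) (c : (intCyc R).carrier) :
    rhoModN R h218i γ (c : ModPow (intCyc R).carrier (S.N : ℕ)) =
      ((intCycAutOfCor218i R h218i γ c : (intCyc R).carrier) : ModPow (intCyc R).carrier (S.N : ℕ)) :=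
  modPowCongr_mk _ _ c

/-- **The coefficient automorphism `γ̄_μ ∈ Aut(μ_N)` of `γ ∈ Aut(Π^tp_X)`** (DEFINED: `ρ_A(γ)` mod `N` read through
the rigidity identification `intModEquiv : (l·Δ_Θ)(M) ⊗ ℤ/N ⥲ μ_N`). [cite: MochizukiEtTh2009, Cor 2.19(iii) p.65] -/
def coeffAut (h218i : R.Cor218_i) (γ : R.PiX ≃ₜ* R.PiX) : R.mu ≃* R.mu :=
  (intModEquiv R).symm.trans ((rhoModN R h218i γ).trans (intModEquiv R))

/-- Defining square of `coeffAut`: `γ̄_μ ∘ intModEquiv = intModEquiv ∘ ρ_A(γ)`.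
[cite: MochizukiEtTh2009, Cor 2.19(iii) p.65] -/
theorem coeffAut_intModEquiv (h218i : R.Cor218_i) (γ : R.PiX ≃ₜ* R.PiX) (m : ModPow (intCyc R).carrier (S.N : ℕ)) :
    coeffAut R h218i γ (intModEquiv R m) = intModEquiv R (rhoModN R h218i γ m) := by
  unfold coeffAut
  rw [MulEquiv.trans_apply, MulEquiv.trans_apply, MulEquiv.symm_apply_apply]

/-- **`γ̄_μ` IS L2's coefficient automorphism through `thetaMod`**: `thetaMod (γ g) = γ̄_μ (thetaMod g)` for all
`g` in the inverse image of `l·Δ_Θ` (PROVED; cf. `RigidData.exists_mulEquiv_thetaMod_comp`, here made canonical).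
[cite: MochizukiEtTh2009, Cor 2.19(iii) p.65] -/
theorem thetaMod_coeffAut (h218i : R.Cor218_i) (γ : R.PiX ≃ₜ* R.PiX) (g : R.lDeltaTheta) (hg : γ g ∈ R.lDeltaTheta) :
    R.thetaMod ⟨γ g, hg⟩ = coeffAut R h218i γ (R.thetaMod g) := by
  -- write `thetaMod g` as `intModEquiv` of the class of `g`
  have h1 : R.thetaMod g = intModEquiv R (((intCycEquiv R).symm (g : lDeltaQuot R) : (intCyc R).carrier) :
      ModPow (intCyc R).carrier (S.N : ℕ)) := by
    unfold intModEquiv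
    rw [MulEquiv.trans_apply, modPowCongr_mk, MulEquiv.apply_symm_apply, lDeltaModEquiv_mk_mk]
  rw [h1, coeffAut_intModEquiv, rhoModN_mk]
  unfold intModEquiv
  rw [MulEquiv.trans_apply, modPowCongr_mk, intCycAutOfCor218i, intCycEquiv_intCycAut,
    MulEquiv.apply_symm_apply, SubquotientKit.autQuot_mk, lDeltaModEquiv_mk_mk]
  rfl

/-- **`ρ_B = γ̄_μ` is the action of the LIFTS** ([EtTh] Cor. 2.18 (iv) / 2.19 (i), row S10c): every automorphism
of the model mono-theta environment `M_η` lying over `γ` acts on `μ_N ⊆ Π^tp_Y[μ_N]` by `γ̄_μ`, GIVEN Cor. 2.19 (i)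
(`Cor219_i_splittings`). PROVED (from `RigidData.iso_inMu_eq_coeffAut_of_cor219`).
[cite: MochizukiEtTh2009, Cor 2.19(i) p.64] -/
theorem iso_inMu_eq_coeffAut' (h218i : R.Cor218_i) (h219 : R.Cor219_i_splittings) {η : R.PiYdd → R.mu} (hη : η ∈ R.thetaCocycles)
    (α : (R.modelMono hη).Iso (R.modelMono hη)) (γ : R.PiX ≃ₜ* R.PiX)
    (hαγ : ∀ x : R.env, ((CycEnvelope.proj R.augY R.chi (α.e x) : R.PiY) : R.PiX) =
      γ ((CycEnvelope.proj R.augY R.chi x : R.PiY) : R.PiX)) (a : R.mu) :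
    α.e (CycEnvelope.inMu R.augY R.chi a) = CycEnvelope.inMu R.augY R.chi (coeffAut R h218i γ a) :=
  RigidData.iso_inMu_eq_coeffAut_of_cor219 h219 hη α γ.toMulEquiv hαγ (coeffAut R h218i γ)
    (fun g hg => thetaMod_coeffAut R h218i γ g hg) a

/-! ## The base datum mod `N` and the functorial family -/

/-- `Π₀ := Π^tp_X`, an isomorph of `Π^tp_{X̲̲_k}` via the frame identification `eX`.
[claim: Mochizuki2012, status: disputed] (IUTchII §1 Cor 1.10, kurims p.47) -/
def basePoint (eX : R.PiX ≃ₜ* S.PiX) : IsoClass S.PiX := ⟨TopGroup.of R.PiX, ⟨eX⟩⟩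

/-- **The base datum of [IUTchII] Cor. 1.10 at the [EtTh] model, mod `N`** (DEFINED, all laws PROVED; hypothesis:
[EtTh] Cor. 2.18 (i)). [claim: Mochizuki2012, status: disputed] (IUTchII §1 Cor 1.10, kurims p.47) -/
def baseDatumModN (h218i : R.Cor218_i) (eX : R.PiX ≃ₜ* S.PiX) : MonoThetaBaseDatum S (basePoint R eX) where
  A := intModN R
  B := CommGrpCat.of R.mu
  actA := actModN R
  actB := R.chi.comp R.aug
  iso := intModEquiv R
  equivariant x m := by
    induction m using QuotientGroup.induction_on with
    | H c =>
      change intModEquiv R (actModN R x (c : ModPow (intCyc R).carrier (S.N : ℕ))) = R.chi (R.aug x) (intModEquiv R (c : ModPow (intCyc R).carrier (S.N : ℕ)))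
      rw [actModN_mk, intModEquiv_conj]
  rhoA γ := rhoModN R h218i γ
  rhoB γ := coeffAut R h218i γ
  rhoA_refl := by
    refine MulEquiv.ext fun m => ?_
    induction m using QuotientGroup.induction_on with
    | H c =>
      change rhoModN R h218i (ContinuousMulEquiv.refl R.PiX) (c : ModPow (intCyc R).carrier (S.N : ℕ)) = (c : ModPow (intCyc R).carrier (S.N : ℕ))
      rw [rhoModN_mk]
      congr 1
      apply (intCycEquiv R).injective
      rw [intCycAutOfCor218i, intCycEquiv_intCycAut]
      generalize intCycEquiv R c = q
      induction q using QuotientGroup.induction_on with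
      | H a => rw [SubquotientKit.autQuot_mk]; rfl
  rhoB_refl := by
    refine MulEquiv.ext fun a => ?_
    obtain ⟨m, rfl⟩ := (intModEquiv R).surjective a
    change coeffAut R h218i (ContinuousMulEquiv.refl R.PiX) (intModEquiv R m) = intModEquiv R m
    rw [coeffAut_intModEquiv]
    congr 1
    induction m using QuotientGroup.induction_on with
    | H c =>
      rw [rhoModN_mk]
      congr 1
      apply (intCycEquiv R).injective
      rw [intCycAutOfCor218i, intCycEquiv_intCycAut]
      generalize intCycEquiv R c = q
      induction q using QuotientGroup.induction_on with
      | H a => rw [SubquotientKit.autQuot_mk]; rfl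
  rhoA_trans γ δ := by
    change rhoModN R h218i (γ.trans δ) = (rhoModN R h218i γ).trans (rhoModN R h218i δ)
    unfold rhoModN
    rw [← modPowCongr_trans]
    congr 1
    exact intCycAut_trans R γ.toMulEquiv δ.toMulEquiv _ _ _ _ _ _
  rhoB_trans γ δ := by
    refine MulEquiv.ext fun a => ?_
    obtain ⟨m, rfl⟩ := (intModEquiv R).surjective a
    change coeffAut R h218i (γ.trans δ) (intModEquiv R m) =
      coeffAut R h218i δ (coeffAut R h218i γ (intModEquiv R m))
    rw [coeffAut_intModEquiv, coeffAut_intModEquiv, coeffAut_intModEquiv]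
    congr 1
    have h : rhoModN R h218i (γ.trans δ) = (rhoModN R h218i γ).trans (rhoModN R h218i δ) := by
      unfold rhoModN
      rw [← modPowCongr_trans]
      congr 1
      exact intCycAut_trans R γ.toMulEquiv δ.toMulEquiv _ _ _ _ _ _
    rw [h, MulEquiv.trans_apply]
  rhoA_act γ x m := by
    induction m using QuotientGroup.induction_on with
    | H c =>
      change rhoModN R h218i γ (actModN R x (c : ModPow (intCyc R).carrier (S.N : ℕ))) = actModN R (γ x) (rhoModN R h218i γ (c : ModPow (intCyc R).carrier (S.N : ℕ)))
      rw [actModN_mk, rhoModN_mk, rhoModN_mk, actModN_mk, intCycAutOfCor218i_intAct]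
      rfl
  rhoB_act γ x a := by
    obtain ⟨m, rfl⟩ := (intModEquiv R).surjective a
    change coeffAut R h218i γ (R.chi (R.aug x) (intModEquiv R m)) =
      R.chi (R.aug (γ x)) (coeffAut R h218i γ (intModEquiv R m))
    induction m using QuotientGroup.induction_on with
    | H c =>
      rw [← intModEquiv_conj, coeffAut_intModEquiv, coeffAut_intModEquiv, rhoModN_mk, rhoModN_mk,
        ← intModEquiv_conj, intCycAutOfCor218i_intAct]
      rfl
  rho_comm γ m := by
    change intModEquiv R (rhoModN R h218i γ m) = coeffAut R h218i γ (intModEquiv R m)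
    rw [coeffAut_intModEquiv]

/-- **The functorial family of [IUTchII] Cor. 1.10 at the [EtTh] model, mod `N`** (modulo [EtTh] Cor. 2.18 (i)):
`Π ↦ ((l·Δ_Θ)(M) ⊗ ℤ/N, μ_N, Def. 1.1 (ii) iso)` with transports from `Aut(Π^tp_X)` (DEFINED via
`MonoThetaBaseDatum.family`, p415127). [claim: Mochizuki2012, status: disputed] (IUTchII §1 Cor 1.10, kurims p.47) -/
def familyModN (h218i : R.Cor218_i) (eX : R.PiX ≃ₜ* S.PiX) : MonoThetaRigidityData S := (baseDatumModN R h218i eX).family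

/-- **[IUTchII] Cor. 1.10 at the [EtTh] model, mod `N`** (PROVED modulo [EtTh] Cor. 2.18 (i)): for the functor
`ℛ → ℱ` determined by `familyModN`, "the resulting natural functor `Ψ_ℛ : ℛ → ℛ†` is multiradially defined".
[claim: Mochizuki2012, status: disputed] (IUTchII §1 Cor 1.10, kurims p.47) -/
theorem cor110_multiradiallyDefined_modelModN (h218i : R.Cor218_i) (eX : R.PiX ≃ₜ* S.PiX) (Γxμ : Type u) [Group Γxμ] :
    ((ex18iii S Γxμ).toDagger
      (CategoryTheory.Prod.fst _ _ ⋙ (familyModN R h218i eX).toRigidityFunctor.Ξ)).IsMultiradiallyDefined :=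
  (baseDatumModN R h218i eX).cor110_multiradiallyDefined_ofBase Γxμ

end ModelCyclotomes

end Literature.IUT.HodgeArakelov
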